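import Summits.AnomalousDissipation.AnomalousDissipation.Theorems.SolenoidalFractalHomogenisationLagrangianStepCellLawVOddGainDefectLowerEdge
import Summits.AnomalousDissipation.AnomalousDissipation.Theorems.SolenoidalFractalHomogenisationLagrangianStepCellLawVOddGainDefectWindows
import HarnessLib

/-!
# K1L `LagrangianRenormalisationStep(Design)` (K1L_D, stmt-AnomalousDissipation-27980; aside 24912), stub `stub_cellLawV0_IS`
# — W5 odd half, O2⁺ (iii): the per-slot package for SECTORIAL blocks and the STRICT sectorial contraction of `excQS W₀ M S` from slot SCALARS
# (helper; `--supports stmt-AnomalousDissipation-27980`)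

Summits-side helper file of route `SolenoidalFractalHomogenisation` (prover seat `ad-k1l-cellLawV-w1` g2; tenure D24-14 «assemble odd (W)»), on top of
`…CellLawVOddGainDefectLowerEdge.lean` (`lowerEdgeTarget_holds`, `abs_form_qsResp_sub_comm_le`) and p5/k3l's `…CellLawVOddGainDefectWindows`
(`oddSectorial_excQS_strict_of_slotWindows`, p651574).  The per-slot hypothesis `hL1` of `oddSectorial_excQS_strict_of_slot` (p650822) asks,
for every block `B` in the Kato sector `τ` with window `[lo, hi]`, that the slot response `f_{T_s}(B)` be (a) in the sector `τ` and (b) transversely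
windowed.  For SECTORIAL (non-symmetric) blocks neither is free at finite `T`; this file discharges both from slot SCALARS:
* `qsRespMoment_nonneg`; **`sector_form_qsResp_of_sectorial`** — (a) with the response sector `τ'`: if `m = f_T(hi) − (τhi/2)g_T(lo) ≥ 0` and
  `τ·hi·g_T(lo) ≤ τ'·m` then `(xᵀf z − zᵀf x)² ≤ τ'²(xᵀf x)(zᵀf z)` (sector growth `τ' ≈ τ·(hi/lo)²` for `T → ∞`; non-negative diagonal included,
  k3l's typing remark (i));
* **`oddSectorial_excQS_of_sectorial`** — for the cubature word `W₀`, `M ≥ 0`, window `0 < lo ≤ 1 ≤ hi`, block sector `τ`, response sector `τ'`,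
  one box `[y, c·y]`: if every slot's scalars satisfy `y ≤ m_s`, `f_{T_s}(lo) ≤ c·y`, `τ·hi·g_{T_s}(lo) ≤ τ'·m_s`, then
  `NearIso S lo hi ∧ OddSectorial S τ ⇒ OddSectorial (excQS W₀ M S) ((c√5/3)·τ')` — NO response-level hypothesis left; contraction factor
  `κ = (c√5/3)·(τ'/τ)` (design: `κ ≈ 0.745·ΛV⁶·(1 + O(τ₀) + saturation)` for the window `[1/ΛV, ΛV]`, so `κ < 1` wants `ΛV ≲ 1.04`; the stub's
  `∃ ΛV > 1` absorbs it).  What remains for the odd half of (W) proper: the Φν definition (D1) relating the true cell map to `(1/N)·excQS` + O7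
  mixing `ε`, and the numeric instantiation of the slot scalars `f_{T_s}, g_{T_s}` at the design point.
Everything PROVED, no definition, no named fact, no sorry.  Infrastructure for route-1's rung leaf F-D1.A0 (frontier FORMAL rung); NOT a proof of the
stub, of the crux, of Onsager's conjecture or of anomalous dissipation.  Prover seat `ad-k1l-cellLawV-w1` g2, 2026-08-28.
-/

set_option linter.dupNamespace false

noncomputable section

namespace Summit.AnomalousDissipation.AnomalousDissipation.Theorems.SolenoidalFractalHomogenisation.LagrangianStep.OddGain

open Matrix Finset MeasureTheory Set
open Literature.Analysis.ODE.PeriodicAveraging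

/-! ## §5 The per-slot package for SECTORIAL blocks and the strict sectorial contraction of `excQS W₀ M S` -/

section Slot

open Literature.Analysis Literature.Analysis.FunctionSpaces Literature.Analysis.FluidPDE
open Literature.Analysis.FluidPDE.LatticeShear

/-- The first kernel moment is non-negative (`T ≥ 0`). [folklore] -/
theorem qsRespMoment_nonneg (ρ : ℝ) {T : ℝ} (hT : 0 ≤ T) (a : ℝ) : 0 ≤ qsRespMoment ρ T a := by
  have h := qsKernel_mono (ρ := ρ) hT (g := fun _ => (0:ℝ)) (h := fun t => t * Real.exp (-t * a)) continuous_const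
    (by fun_prop) (fun t ht => by positivity)
  simp only [mul_zero, intervalIntegral.integral_zero] at h
  unfold qsRespMoment
  exact h

/-- **RESPONSE SECTOR OF A SECTORIAL BLOCK** (the first conjunct of `hL1` in `oddSectorial_excQS_strict_of_slot`, for non-symmetric blocks):
if `B` is in the Kato sector `τ` with window `[lo, hi]` (`0 < lo`), `T ≥ 0`, the first-order lower edge `m = f_T(hi) − (τhi/2)g_T(lo)` is `≥ 0`
and `τ·hi·g_T(lo) ≤ τ'·m`, then the form of `f_T(B)` is in the Kato sector `τ'` (with non-negative diagonal):
`(xᵀf z − zᵀf x)² ≤ τ'²·(xᵀf x)(zᵀf z)` — `abs_form_qsResp_sub_comm_le` over `lowerEdgeTarget_holds`. [folklore] -/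
theorem sector_form_qsResp_of_sectorial {ρ T : ℝ} (hT : 0 ≤ T) {B : Matrix (Fin 3) (Fin 3) ℝ} {τ lo hi τ' : ℝ} (hτ : 0 ≤ τ)
    (hlo : 0 < lo)
    (hsec : ∀ x z : Fin 3 → ℝ, (x ⬝ᵥ B *ᵥ z - z ⬝ᵥ B *ᵥ x) ^ 2 ≤ τ ^ 2 * ((x ⬝ᵥ B *ᵥ x) * (z ⬝ᵥ B *ᵥ z)))
    (hwin : ∀ x : Fin 3 → ℝ, lo * (x ⬝ᵥ x) ≤ x ⬝ᵥ B *ᵥ x ∧ x ⬝ᵥ B *ᵥ x ≤ hi * (x ⬝ᵥ x))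
    (hm : 0 ≤ qsRespScalar ρ T hi - τ * hi / 2 * qsRespMoment ρ T lo)
    (hgrow : τ * hi * qsRespMoment ρ T lo ≤ τ' * (qsRespScalar ρ T hi - τ * hi / 2 * qsRespMoment ρ T lo))
    (x z : Fin 3 → ℝ) :
    (x ⬝ᵥ (qsResp ρ T B) *ᵥ z - z ⬝ᵥ (qsResp ρ T B) *ᵥ x) ^ 2 ≤
      τ' ^ 2 * ((x ⬝ᵥ (qsResp ρ T B) *ᵥ x) * (z ⬝ᵥ (qsResp ρ T B) *ᵥ z)) := by
  set m := qsRespScalar ρ T hi - τ * hi / 2 * qsRespMoment ρ T lo with hmdef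
  set K := τ * hi * qsRespMoment ρ T lo with hKdef
  have hlohi : lo ≤ hi := lo_le_hi_of_window hwin
  have hK : 0 ≤ K := mul_nonneg (mul_nonneg hτ (hlo.le.trans hlohi)) (qsRespMoment_nonneg ρ hT lo)
  have hxx : 0 ≤ x ⬝ᵥ x := by rw [self_dotProduct_eq_sum_sq]; exact Finset.sum_nonneg fun i _ => sq_nonneg _
  have hzz : 0 ≤ z ⬝ᵥ z := by rw [self_dotProduct_eq_sum_sq]; exact Finset.sum_nonneg fun i _ => sq_nonneg _
  have hD := abs_form_qsResp_sub_comm_le (ρ := ρ) hT hτ hlo hsec hwin x z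
  have hfx : m * (x ⬝ᵥ x) ≤ x ⬝ᵥ (qsResp ρ T B) *ᵥ x := lowerEdgeTarget_holds ρ T hT B τ lo hi hτ hlo hsec hwin x
  have hfz : m * (z ⬝ᵥ z) ≤ z ⬝ᵥ (qsResp ρ T B) *ᵥ z := lowerEdgeTarget_holds ρ T hT B τ lo hi hτ hlo hsec hwin z
  have hD2 : (x ⬝ᵥ (qsResp ρ T B) *ᵥ z - z ⬝ᵥ (qsResp ρ T B) *ᵥ x) ^ 2 ≤ K ^ 2 * ((x ⬝ᵥ x) * (z ⬝ᵥ z)) := by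
    have h1 : |x ⬝ᵥ (qsResp ρ T B) *ᵥ z - z ⬝ᵥ (qsResp ρ T B) *ᵥ x| ≤ K * (Real.sqrt (x ⬝ᵥ x) * Real.sqrt (z ⬝ᵥ z)) := hD
    have h2 := pow_le_pow_left₀ (abs_nonneg _) h1 2
    rw [sq_abs] at h2
    calc _ ≤ (K * (Real.sqrt (x ⬝ᵥ x) * Real.sqrt (z ⬝ᵥ z))) ^ 2 := h2
      _ = K ^ 2 * ((x ⬝ᵥ x) * (z ⬝ᵥ z)) := by
          rw [mul_pow K, mul_pow (Real.sqrt (x ⬝ᵥ x)), Real.sq_sqrt hxx, Real.sq_sqrt hzz]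
  have hKm : K ≤ τ' * m := hgrow
  have hmx : 0 ≤ m * (x ⬝ᵥ x) := mul_nonneg hm hxx
  have hmz : 0 ≤ m * (z ⬝ᵥ z) := mul_nonneg hm hzz
  calc (x ⬝ᵥ (qsResp ρ T B) *ᵥ z - z ⬝ᵥ (qsResp ρ T B) *ᵥ x) ^ 2 ≤ K ^ 2 * ((x ⬝ᵥ x) * (z ⬝ᵥ z)) := hD2
    _ ≤ (τ' * m) ^ 2 * ((x ⬝ᵥ x) * (z ⬝ᵥ z)) :=
        mul_le_mul_of_nonneg_right (pow_le_pow_left₀ hK hKm 2) (mul_nonneg hxx hzz)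
    _ = τ' ^ 2 * ((m * (x ⬝ᵥ x)) * (m * (z ⬝ᵥ z))) := by ring
    _ ≤ τ' ^ 2 * ((x ⬝ᵥ (qsResp ρ T B) *ᵥ x) * (z ⬝ᵥ (qsResp ρ T B) *ᵥ z)) :=
        mul_le_mul_of_nonneg_left (mul_le_mul hfx hfz hmz (hmx.trans hfx)) (sq_nonneg _)

/-- **STRICT SECTORIAL CONTRACTION OF THE QUASI-STATIC EXCESS FOR SECTORIAL BACKGROUNDS — per-slot hypotheses on slot SCALARS only.**
For the cubature word `W₀`, Lagrangian parameter `M ≥ 0`, a window `0 < lo ≤ 1 ≤ hi`, a block sector `τ ≥ 0`, a response sector `τ' ≥ 0` and one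
box `[y, c·y]` (`y, c ≥ 0`): if for every slot `s` (relaxation `T_s = 4π²|m_s|²Mτ_s`, `f = qsRespScalar ρ T_s`, `g = qsRespMoment ρ T_s`) the
SCALAR inequalities `y ≤ f(hi) − (τhi/2)g(lo)`, `f(lo) ≤ c·y` and `τ·hi·g(lo) ≤ τ'·(f(hi) − (τhi/2)g(lo))` hold, then every background `S` with
`NearIso S lo hi` in the Kato sector `τ` has `excQS W₀ M S` in the sector `(c√5/3)·τ'`.  Composition of p5's `oddSectorial_excQS_strict_of_slotWindows`
(p651574) with THIS FILE's per-slot package (`sector_form_qsResp_of_sectorial`, `window_clause_of_lowerEdgeTarget` over `lowerEdgeTarget_holds`)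
and k3l g4's `sectorForm_regBlock` / `window_regBlock` (p644915): no response-level hypothesis is left — the odd half of the W5 window at the
quasi-static level, with contraction factor `κ = (c√5/3)·(τ'/τ)`. [folklore] -/
theorem oddSectorial_excQS_of_sectorial (Mlag : ℝ) (hM : 0 ≤ Mlag) {lo hi τ τ' y c : ℝ} (hlo : 0 < lo) (hlo1 : lo ≤ 1) (hhi1 : 1 ≤ hi)
    (hy : 0 ≤ y) (hc : 0 ≤ c) (hτ : 0 ≤ τ) (hτ' : 0 ≤ τ')
    (hslot : ∀ s : Fin 26,
      y ≤ qsRespScalar cubatureWord.ramp (4 * Real.pi ^ 2 * ‖Torus.latticeVec (cubatureWord.phase s).m‖ ^ 2 * Mlag *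
          (cubatureWord.phase s).τ) hi -
        τ * hi / 2 * qsRespMoment cubatureWord.ramp (4 * Real.pi ^ 2 * ‖Torus.latticeVec (cubatureWord.phase s).m‖ ^ 2 * Mlag *
          (cubatureWord.phase s).τ) lo ∧
      qsRespScalar cubatureWord.ramp (4 * Real.pi ^ 2 * ‖Torus.latticeVec (cubatureWord.phase s).m‖ ^ 2 * Mlag *
          (cubatureWord.phase s).τ) lo ≤ c * y ∧
      τ * hi * qsRespMoment cubatureWord.ramp (4 * Real.pi ^ 2 * ‖Torus.latticeVec (cubatureWord.phase s).m‖ ^ 2 * Mlag *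
          (cubatureWord.phase s).τ) lo ≤
        τ' * (qsRespScalar cubatureWord.ramp (4 * Real.pi ^ 2 * ‖Torus.latticeVec (cubatureWord.phase s).m‖ ^ 2 * Mlag *
            (cubatureWord.phase s).τ) hi -
          τ * hi / 2 * qsRespMoment cubatureWord.ramp (4 * Real.pi ^ 2 * ‖Torus.latticeVec (cubatureWord.phase s).m‖ ^ 2 * Mlag *
            (cubatureWord.phase s).τ) lo))
    {S : Torus.Visc4 (Fin 3)} (hS : Torus.NearIso S lo hi) (hodd : OddSectorial S τ) :
    OddSectorial (excQS cubatureWord Mlag S) (c * Real.sqrt 5 / 3 * τ') := by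
  have hform : ∀ s (x z : Fin 3 → ℝ), x ⬝ᵥ (slotQ cubatureWord Mlag S s) *ᵥ z =
      ((projPerp (slotN s)) *ᵥ x) ⬝ᵥ (qsResp cubatureWord.ramp (4 * Real.pi ^ 2 * ‖Torus.latticeVec (cubatureWord.phase s).m‖ ^ 2 *
        Mlag * (cubatureWord.phase s).τ) (regBlock S (slotN s))) *ᵥ ((projPerp (slotN s)) *ᵥ z) := by
    intro s x z
    rw [← sum_sum_eq_form, slotQ_form_eq, slotN]
  have hT : ∀ s : Fin 26, 0 ≤ 4 * Real.pi ^ 2 * ‖Torus.latticeVec (cubatureWord.phase s).m‖ ^ 2 * Mlag * (cubatureWord.phase s).τ :=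
    fun s => slotT_nonneg hM cubatureWord s
  have hsecB : ∀ s : Fin 26, ∀ x z : Fin 3 → ℝ, (x ⬝ᵥ (regBlock S (slotN s)) *ᵥ z - z ⬝ᵥ (regBlock S (slotN s)) *ᵥ x) ^ 2 ≤
      τ ^ 2 * ((x ⬝ᵥ (regBlock S (slotN s)) *ᵥ x) * (z ⬝ᵥ (regBlock S (slotN s)) *ᵥ z)) :=
    fun s => sectorForm_regBlock (sum_mhat_sq _) hS hlo.le hodd
  have hwinB : ∀ s : Fin 26, ∀ x : Fin 3 → ℝ, lo * (x ⬝ᵥ x) ≤ x ⬝ᵥ (regBlock S (slotN s)) *ᵥ x ∧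
      x ⬝ᵥ (regBlock S (slotN s)) *ᵥ x ≤ hi * (x ⬝ᵥ x) :=
    fun s => window_regBlock (sum_mhat_sq _) hS hlo1 hhi1
  refine oddSectorial_excQS_strict_of_slotWindows Mlag S hy hc hτ'
    (fun s => qsRespScalar cubatureWord.ramp (4 * Real.pi ^ 2 * ‖Torus.latticeVec (cubatureWord.phase s).m‖ ^ 2 * Mlag *
          (cubatureWord.phase s).τ) hi -
        τ * hi / 2 * qsRespMoment cubatureWord.ramp (4 * Real.pi ^ 2 * ‖Torus.latticeVec (cubatureWord.phase s).m‖ ^ 2 * Mlag *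
          (cubatureWord.phase s).τ) lo)
    (fun s => qsRespScalar cubatureWord.ramp (4 * Real.pi ^ 2 * ‖Torus.latticeVec (cubatureWord.phase s).m‖ ^ 2 * Mlag *
          (cubatureWord.phase s).τ) lo)
    (fun s => (hslot s).1) (fun s => (hslot s).2.1) (fun s x z => ?_) (fun s x => ?_)
  · rw [hform, hform, hform, hform]
    exact sector_form_qsResp_of_sectorial (hT s) hτ hlo (hsecB s) (hwinB s) (hy.trans (hslot s).1) (hslot s).2.2 _ _
  · rw [hform]
    exact window_clause_of_lowerEdgeTarget (lowerEdgeTarget_holds _) (hT s) hτ hlo (hsecB s) (hwinB s) s x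

end Slot

end Summit.AnomalousDissipation.AnomalousDissipation.Theorems.SolenoidalFractalHomogenisation.LagrangianStep.OddGain

end
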